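import Summits.QuantumFields.YangMills.Theorems.IR.BlockedActivityDefs
import Summits.QuantumFields.YangMills.Theorems.BalabanLadderIRFrameCells
import HarnessLib

/-!
# Crux `IR` (stmt-QuantumFields-19354), lane B: CALIBRATION of the blocked-activity class, part 1/2 — the mesh-1 Wilson
# representation: cells, data, measurability and locality

Helper module for item `stmt-QuantumFields-19354` (`--supports`; it closes nothing), lane `ym-19354-onsetsc-p2`
(«strong coupling AFTER blocking»).  This part and `Theorems/IR/BlockedActivityCalibration` (part 2/2) show that the lane's
interface `BlockedRep ∕ BlockedActivityClass` (`Theorems/IR/BlockedActivityDefs`, p527934) is INSTANTIATED by the actual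
Wilson kernels at mesh `b = 1` in the strong-coupling window `|β| ≤ β_B(a)` — «strong coupling BEFORE blocking»: the
lane's open construction statement `BlockedActivityOnsetSC` asks for the same representation AFTER blocking to `b(β) ≍ ξ(β)`.

THE MESH-1 WILSON REPRESENTATION of the kernel `ymSpecification ρ β Λ σ`, `Λ = regionEdges w Y` (frame `w` of mesh `1`):
* reference space `Ω = (Λ → G)` with the product Haar measure (σ-independent);
* cell σ-algebra `cellSigma w Λ c` = generated by the coordinates `Ecell w Λ c` = the links of `Λ` lying in the FORWARD
  neighbours `c'`, `c ≤ c' ≤ c + 1`, of `c` (`Fwd`); non-touching cell sets have disjoint coordinate sets (part 2);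
* the plaquettes `Pcell w Λ c` of the kernel BASED in `c` (frame cell of the base point, `baseCell`; tree `frameCell`), their
  one-plaquette weights `plaqWeight ρ β p = e^{-β (N − Re tr ρ(U_p))}` and the CELL FACTOR
  `cellFactor ρ β w Λ σ c = ∏_{p ∈ Pcell c} plaqWeight p (ζ ∨ σ) − 1` (exterior datum glued in, tree `glueWith`);
* the perturbed cells `Ccells w Λ` (base cells of the kernel's plaquettes) and the realisation `obsReal Λ f ζ = f (ζ ∨ 1)`.
Proved here: frame monotonicity (`frameIdx_mono`, `frameIdx_succ_le`), «the edges of a plaquette lie in forward neighbours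
of its base cell» (`fwd_baseCell_frameCell`), measurability of `plaquetteObs` WITHOUT second countability
(`measurable_plaquetteObs_of_continuous'`, the route of `Tempered.measurable_wilsonBoundaryAction_of_continuous`), the
factorisation principle for `cellSigma` (`measurable_cellSigma_of_factor`, restriction `restr` ∕ extension `ext`),
`measurable_cellFactor` (the factor of `c` is `cellSigma c`-measurable) and `cellFactor_local` (it reads the exterior datum
only on the cells adjacent to `c` outside `Y`).

HONEST FRAMING: strong-coupling bookkeeping at the smallest mesh; nothing about weak coupling, the onset, the gap or Clay.
No `sorry`; axioms ⊆ {propext, Classical.choice, Quot.sound}; no instances, no notation.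
Refs: SeilerLNP1982 Ch. 2; OsterwalderSeilerAnnPhys1978 §3; FriedliVelenik2017 §5.7.1; Georgii2011 Def. 2.9.
-/

set_option autoImplicit false

noncomputable section

open MeasureTheory ProbabilityTheory
open Literature.MathematicalPhysics.QuantumFieldTheory (haarProbability)
open Literature.MathematicalPhysics.QuantumLattice
open Literature.Probability.LatticeModels (IsLocalPerturbation IsLocalObservable pertExpect pertNum pertZ Touches glueWith
  glueWith_apply_mem glueWith_apply_not_mem measurable_glueWith)
open Summit.QuantumFields.YangMills.Cruxes.IR.Tempered (cellEdges windowCells regionEdges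
  integral_ymSpecification_of_continuous)
open Summit.QuantumFields.YangMills.Cruxes.IR.CellTempered.Engine (frameIdx frameCell frameCell_eq_iff
  mem_cellEdges_frameCell frameIdx_le lt_frameIdx_succ frameIdx_eq_iff frame_add_nat_le)

namespace Summit.QuantumFields.YangMills.Cruxes.IR.BlockedActivity

/-! ## §1 Frame geometry at mesh `≥ 1`: forward cells of a plaquette -/

section Geometry

variable {f : ℤ → ℤ} (hf : ∀ j, f j + 1 ≤ f (j + 1))
include hf

/-- A frame sequence is monotone. -/
theorem frameSeq_mono {j j' : ℤ} (h : j ≤ j') : f j ≤ f j' := by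
  obtain ⟨m, rfl⟩ := Int.le.dest h
  have := frame_add_nat_le hf j m
  have hm : (0 : ℤ) ≤ m := Int.natCast_nonneg m
  linarith

/-- `frameIdx` is monotone. -/
theorem frameIdx_mono {t t' : ℤ} (h : t ≤ t') : frameIdx f t ≤ frameIdx f t' := by
  by_contra hlt
  push Not at hlt
  have h1 : frameIdx f t' + 1 ≤ frameIdx f t := hlt
  have h2 := frameSeq_mono hf h1
  have h3 := lt_frameIdx_succ hf t'
  have h4 := frameIdx_le hf t
  omega

/-- `frameIdx (t + 1) ≤ frameIdx t + 1` (cells have width `≥ 1`). -/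
theorem frameIdx_succ_le (t : ℤ) : frameIdx f (t + 1) ≤ frameIdx f t + 1 := by
  by_contra hlt
  push Not at hlt
  have h1 : frameIdx f t + 2 ≤ frameIdx f (t + 1) := by omega
  have h2 := frameSeq_mono hf h1
  have h3 := lt_frameIdx_succ hf t
  have h4 := hf (frameIdx f t + 1)
  have h5 := frameIdx_le hf (t + 1)
  have : frameIdx f t + 1 + 1 = frameIdx f t + 2 := by ring
  rw [this] at h4
  omega

end Geometry

/-- `c'` is a FORWARD neighbour of `c`: `c ≤ c' ≤ c + 1` coordinatewise. -/
abbrev Fwd (c c' : Cell) : Prop := ∀ i : Fin 4, c i ≤ c' i ∧ c' i ≤ c i + 1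

/-- Forward neighbours are adjacent (in both orders). -/
theorem cellAdj_of_fwd {c c' : Cell} (h : Fwd c c') : CellAdj c' c := fun i => by
  have := h i; rw [abs_le]; constructor <;> omega

/-- Two cells with a common forward neighbour are adjacent. -/
theorem cellAdj_of_fwd_of_fwd {c₁ c₂ c' : Cell} (h₁ : Fwd c₁ c') (h₂ : Fwd c₂ c') : CellAdj c₁ c₂ := fun i => by
  have := h₁ i; have := h₂ i; rw [abs_le]; constructor <;> omega

/-- The base cell of a plaquette: the frame cell of its base point. -/
def baseCell (w : Fin 4 → ℤ → ℤ) (p : ZdPlaquette 4) : Cell := frameCell w (p.1, p.2.1.1)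

section Frame

variable {w : Fin 4 → ℤ → ℤ} (hw : ∀ i j, w i j + 1 ≤ w i (j + 1))
include hw

/-- The edges of a plaquette lie in forward neighbours of its base cell. -/
theorem fwd_baseCell_frameCell (p : ZdPlaquette 4) {e : ZdEdge 4} (he : e ∈ plaquetteEdges p) :
    Fwd (baseCell w p) (frameCell w e) := by
  intro i
  simp only [plaquetteEdges, Finset.mem_insert, Finset.mem_singleton] at he
  have key : ∀ x : Fin 4 → ℤ, (x i = p.1 i ∨ x i = p.1 i + 1) →
      frameIdx (w i) (p.1 i) ≤ frameIdx (w i) (x i) ∧ frameIdx (w i) (x i) ≤ frameIdx (w i) (p.1 i) + 1 := by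
    intro x hx
    rcases hx with hx | hx
    · rw [hx]; constructor <;> omega
    · rw [hx]; exact ⟨frameIdx_mono (hw i) (by omega), frameIdx_succ_le (hw i) _⟩
  have hsingle : ∀ (k : Fin 4), (p.1 + Pi.single k 1 : Fin 4 → ℤ) i = p.1 i ∨
      (p.1 + Pi.single k 1 : Fin 4 → ℤ) i = p.1 i + 1 := by
    intro k
    by_cases hik : i = k
    · subst hik; right; simp
    · left; simp [Pi.add_apply, Pi.single_eq_of_ne hik]
  simp only [baseCell, frameCell]
  rcases he with rfl | rfl | rfl | rfl
  · exact key _ (Or.inl rfl)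
  · exact key _ (hsingle _)
  · exact key _ (hsingle _)
  · exact key _ (Or.inl rfl)

end Frame

/-! ## §2 The mesh-1 Wilson representation: data -/

section Data

variable {G : Type} [Group G] [TopologicalSpace G] [IsTopologicalGroup G] [CompactSpace G]
  [MeasurableSpace G] [BorelSpace G] {N : ℕ} (ρ : G →* Matrix (Fin N) (Fin N) ℂ) (β : ℝ)
  (w : Fin 4 → ℤ → ℤ) (Λ : Finset (ZdEdge 4))

/-- The coordinates (edges of `Λ`) lying in forward neighbours of the cell `c`. -/
def Ecell (c : Cell) : Finset ↥Λ := Finset.univ.filter fun e => Fwd c (frameCell w e.1)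

/-- The local σ-algebra of the cell `c`: generated by the coordinates in its forward neighbours. -/
abbrev cellSigma (c : Cell) : MeasurableSpace (↥Λ → G) :=
  ⨆ e ∈ Ecell w Λ c, (‹MeasurableSpace G›).comap fun ζ : ↥Λ → G => ζ e

/-- The plaquettes of the kernel of `Λ` based in the cell `c`. -/
def Pcell (c : Cell) : Finset (ZdPlaquette 4) := (plaquettesTouching Λ).filter fun p => baseCell w p = c

/-- The Wilson weight of one plaquette. -/
def plaqWeight (p : ZdPlaquette 4) (U : LGConfig 4 G) : ℝ :=
  Real.exp (-β * ((N : ℝ) - plaquetteObs ρ p.1 p.2.1.1 p.2.1.2 U))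

/-- The cell factor of the cell `c` under exterior datum `σ`: the product of the Wilson weights of the plaquettes based
in `c`, minus one. -/
def cellFactor (σ : LGConfig 4 G) (c : Cell) (ζ : ↥Λ → G) : ℂ :=
  ((∏ p ∈ Pcell w Λ c, plaqWeight ρ β p (glueWith Λ ζ σ) : ℝ) : ℂ) - 1

/-- The perturbed cells: the base cells of the kernel's plaquettes. -/
def Ccells : Finset Cell := (plaquettesTouching Λ).image (baseCell w)

/-- The realisation of an observable on the reference space (exterior datum `1`; irrelevant for cylinders of `Λ`). -/
def obsReal (f : LGConfig 4 G → ℝ) (ζ : ↥Λ → G) : ℂ := ((f (glueWith Λ ζ fun _ => 1) : ℝ) : ℂ)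

end Data

/-! ## §3 Measurability and locality of the data -/

section Lemmas

variable {G : Type} [Group G] [TopologicalSpace G] [IsTopologicalGroup G] [CompactSpace G]
  [MeasurableSpace G] [BorelSpace G] {N : ℕ} (ρ : G →* Matrix (Fin N) (Fin N) ℂ) (β : ℝ)
  (w : Fin 4 → ℤ → ℤ) (Λ : Finset (ZdEdge 4))

omit [CompactSpace G] in
/-- The plaquette observable of a continuous representation is measurable for the product σ-algebra (no second
countability of `G`: push the holonomy through `ρ` into `M_N(ℂ)`; cf. `Tempered.measurable_wilsonBoundaryAction_of_continuous`). -/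
theorem measurable_plaquetteObs_of_continuous' (hρ : Continuous ρ) (x : Fin 4 → ℤ) (i j : Fin 4) :
    Measurable (plaquetteObs (G := G) (d := 4) ρ x i j) := by
  letI : MeasurableSpace (Matrix (Fin N) (Fin N) ℂ) := borel _
  haveI : BorelSpace (Matrix (Fin N) (Fin N) ℂ) := ⟨rfl⟩
  haveI : SecondCountableTopology (Matrix (Fin N) (Fin N) ℂ) :=
    inferInstanceAs (SecondCountableTopology (Fin N → Fin N → ℂ))
  have hρm : Measurable ρ := hρ.measurable
  have h1 : ∀ e : ZdEdge 4, Measurable fun U : LGConfig 4 G => ρ (U e) :=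
    fun e => hρm.comp (measurable_pi_apply e)
  have h2 : ∀ e : ZdEdge 4, Measurable fun U : LGConfig 4 G => ρ ((U e)⁻¹) :=
    fun e => hρm.comp (measurable_pi_apply e).inv
  have htr : Measurable fun M : Matrix (Fin N) (Fin N) ℂ => (M.trace).re :=
    (Complex.continuous_re.comp (continuous_id.matrix_trace)).measurable
  have key : Measurable fun U : LGConfig 4 G =>
      ((ρ (U (x, i)) * ρ (U (x + Pi.single i 1, j)) * ρ ((U (x + Pi.single j 1, i))⁻¹) *
        ρ ((U (x, j))⁻¹)).trace).re :=
    htr.comp ((((h1 _).mul (h1 _)).mul (h2 _)).mul (h2 _))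
  convert key using 1
  funext U
  simp only [plaquetteObs, plaquetteHolonomyZd, map_mul]

omit [CompactSpace G] in
/-- The one-plaquette Wilson weight is measurable. -/
theorem measurable_plaqWeight (hρ : Continuous ρ) (p : ZdPlaquette 4) : Measurable (plaqWeight (G := G) ρ β p) :=
  (measurable_const.mul (measurable_const.sub (measurable_plaquetteObs_of_continuous' ρ hρ _ _ _))).exp

omit [TopologicalSpace G] [IsTopologicalGroup G] [CompactSpace G] [MeasurableSpace G] [BorelSpace G] in
/-- The one-plaquette Wilson weight reads only the plaquette's edges. -/
theorem plaqWeight_congr (p : ZdPlaquette 4) {U V : LGConfig 4 G} (h : ∀ e ∈ plaquetteEdges p, U e = V e) :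
    plaqWeight ρ β p U = plaqWeight ρ β p V := by
  unfold plaqWeight
  rw [isCylinder_plaquetteObs ρ p h]

omit [TopologicalSpace G] [IsTopologicalGroup G] [CompactSpace G] [MeasurableSpace G] [BorelSpace G] in
/-- The one-plaquette Wilson weight lies in `[e^{-|β|(N+C)}, e^{|β|(N+C)}]` when `|plaquetteObs| ≤ C`. -/
theorem abs_log_plaqWeight_le {C : ℝ} (hC : ∀ (x : Fin 4 → ℤ) (i j : Fin 4) (U : LGConfig 4 G), |plaquetteObs ρ x i j U| ≤ C)
    (p : ZdPlaquette 4) (U : LGConfig 4 G) :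
    |(-β * ((N : ℝ) - plaquetteObs ρ p.1 p.2.1.1 p.2.1.2 U))| ≤ |β| * ((N : ℝ) + C) := by
  rw [abs_mul, abs_neg]
  refine mul_le_mul_of_nonneg_left ?_ (abs_nonneg β)
  have h := hC p.1 p.2.1.1 p.2.1.2 U
  rw [abs_le] at h ⊢
  constructor <;> nlinarith [h.1, h.2, Nat.cast_nonneg (α := ℝ) N]

omit [Group G] [TopologicalSpace G] [IsTopologicalGroup G] [CompactSpace G] [BorelSpace G] in
/-- The local σ-algebra of a cell is a sub-σ-algebra of the product σ-algebra. -/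
theorem cellSigma_le (c : Cell) : cellSigma (G := G) w Λ c ≤ MeasurableSpace.pi :=
  iSup₂_le fun e _ => (measurable_pi_apply e).comap_le

omit [Group G] [TopologicalSpace G] [IsTopologicalGroup G] [CompactSpace G] [BorelSpace G] in
/-- A coordinate in the forward neighbourhood of `c` is measurable for the cell's σ-algebra. -/
theorem measurable_eval_cellSigma {c : Cell} {e : ↥Λ} (he : e ∈ Ecell w Λ c) :
    Measurable[cellSigma (G := G) w Λ c] fun ζ : ↥Λ → G => ζ e :=
  Measurable.of_comap_le (le_iSup₂ (f := fun (e : ↥Λ) (_ : e ∈ Ecell w Λ c) =>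
    (‹MeasurableSpace G›).comap fun ζ : ↥Λ → G => ζ e) e he)

/-- Restriction to the coordinates of the forward neighbourhood of `c`. -/
def restr (c : Cell) (ζ : ↥Λ → G) : ↥(Ecell w Λ c) → G := fun a => ζ a.1

/-- Extension by `1` off the forward neighbourhood of `c`. -/
def ext (c : Cell) (ξ : ↥(Ecell w Λ c) → G) : ↥Λ → G := fun e => if h : e ∈ Ecell w Λ c then ξ ⟨e, h⟩ else 1

omit [Group G] [TopologicalSpace G] [IsTopologicalGroup G] [CompactSpace G] [BorelSpace G] in
/-- The restriction is measurable for the cell's σ-algebra. -/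
theorem measurable_restr (c : Cell) : Measurable[cellSigma (G := G) w Λ c] (restr (G := G) w Λ c) :=
  @measurable_pi_lambda _ _ _ (cellSigma (G := G) w Λ c) _ _ fun a => measurable_eval_cellSigma w Λ a.2

omit [TopologicalSpace G] [IsTopologicalGroup G] [CompactSpace G] [BorelSpace G] in
/-- The extension is measurable. -/
theorem measurable_ext (c : Cell) : Measurable (ext (G := G) w Λ c) := by
  refine measurable_pi_lambda _ fun e => ?_
  by_cases h : e ∈ Ecell w Λ c
  · simp only [ext, h, dite_true]
    exact measurable_pi_apply _
  · simp only [ext, h, dite_false]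
    exact measurable_const

omit [TopologicalSpace G] [IsTopologicalGroup G] [CompactSpace G] [MeasurableSpace G] [BorelSpace G] in
/-- Extension after restriction is the identity on the forward neighbourhood. -/
theorem ext_restr_apply (c : Cell) (ζ : ↥Λ → G) {e : ↥Λ} (he : e ∈ Ecell w Λ c) :
    ext w Λ c (restr w Λ c ζ) e = ζ e := by
  simp [ext, restr, he]

omit [Group G] [TopologicalSpace G] [IsTopologicalGroup G] [CompactSpace G] [BorelSpace G] in
/-- **Factorisation principle**: a function that factors measurably through the restriction is measurable for the
cell's σ-algebra. -/
theorem measurable_cellSigma_of_factor {X : Type*} [MeasurableSpace X] (c : Cell) {F : (↥Λ → G) → X}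
    {Ft : (↥(Ecell w Λ c) → G) → X} (hFt : Measurable Ft) (hF : ∀ ζ, F ζ = Ft (restr w Λ c ζ)) :
    Measurable[cellSigma (G := G) w Λ c] F := by
  have : F = Ft ∘ restr w Λ c := funext hF
  rw [this]
  exact hFt.comp (measurable_restr w Λ c)

variable {w} (hw : ∀ i j, w i j + 1 ≤ w i (j + 1))
include hw

omit [TopologicalSpace G] [IsTopologicalGroup G] [CompactSpace G] [MeasurableSpace G] [BorelSpace G] in
/-- The edges in `Λ` of a plaquette based in `c` are coordinates of the forward neighbourhood of `c`. -/
theorem mem_Ecell_of_mem_plaquetteEdges {c : Cell} {p : ZdPlaquette 4} (hp : baseCell w p = c)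
    {e : ZdEdge 4} (he : e ∈ plaquetteEdges p) (heΛ : e ∈ Λ) : (⟨e, heΛ⟩ : ↥Λ) ∈ Ecell w Λ c := by
  refine Finset.mem_filter.2 ⟨Finset.mem_univ _, ?_⟩
  rw [← hp]
  exact fwd_baseCell_frameCell hw p he

omit [CompactSpace G] in
/-- The cell factor is measurable for its cell's σ-algebra. -/
theorem measurable_cellFactor (hρ : Continuous ρ) (σ : LGConfig 4 G) (c : Cell) :
    Measurable[cellSigma (G := G) w Λ c] (cellFactor ρ β w Λ σ c) := by
  refine measurable_cellSigma_of_factor w Λ c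
    (Ft := fun ξ => ((∏ p ∈ Pcell w Λ c, plaqWeight ρ β p (glueWith Λ (ext w Λ c ξ) σ) : ℝ) : ℂ) - 1) ?_ ?_
  · refine (Complex.measurable_ofReal.comp (Finset.measurable_prod _ fun p _ => ?_)).sub measurable_const
    exact (measurable_plaqWeight ρ β hρ p).comp ((measurable_glueWith Λ σ).comp (measurable_ext w Λ c))
  · intro ζ
    unfold cellFactor
    congr 2
    refine Finset.prod_congr rfl fun p hp => plaqWeight_congr ρ β p fun e he => ?_
    have hpc : baseCell w p = c := (Finset.mem_filter.1 hp).2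
    by_cases heΛ : e ∈ Λ
    · rw [glueWith_apply_mem _ _ _ heΛ, glueWith_apply_mem _ _ _ heΛ,
        ext_restr_apply w Λ c ζ (mem_Ecell_of_mem_plaquetteEdges Λ hw hpc he heΛ)]
    · rw [glueWith_apply_not_mem _ _ _ heΛ, glueWith_apply_not_mem _ _ _ heΛ]

omit [TopologicalSpace G] [IsTopologicalGroup G] [CompactSpace G] [MeasurableSpace G] [BorelSpace G] in
/-- An edge outside `regionEdges w Y` lies in a cell outside `Y`. -/
theorem frameCell_notMem_of_notMem {Y : Finset Cell} {e : ZdEdge 4} (he : e ∉ regionEdges w Y) :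
    frameCell w e ∉ Y := fun h =>
  he (Finset.mem_biUnion.2 ⟨frameCell w e, h, mem_cellEdges_frameCell hw e⟩)

omit [TopologicalSpace G] [IsTopologicalGroup G] [CompactSpace G] [MeasurableSpace G] [BorelSpace G] in
/-- **Finite range of the exterior dependence**: the cell factor of `p` reads the datum only on the cells adjacent to
`p` outside `Y`. -/
theorem cellFactor_local {Y : Finset Cell} (p : Cell) (σ σ' : LGConfig 4 G)
    (h : ∀ c, CellAdj c p → c ∉ Y → ∀ e ∈ cellEdges w c, σ e = σ' e) :
    cellFactor ρ β w (regionEdges w Y) σ p = cellFactor ρ β w (regionEdges w Y) σ' p := by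
  funext ζ
  unfold cellFactor
  congr 2
  refine Finset.prod_congr rfl fun q hq => plaqWeight_congr ρ β q fun e he => ?_
  have hqc : baseCell w q = p := (Finset.mem_filter.1 hq).2
  by_cases heΛ : e ∈ regionEdges w Y
  · rw [glueWith_apply_mem _ _ _ heΛ, glueWith_apply_mem _ _ _ heΛ]
  · rw [glueWith_apply_not_mem _ _ _ heΛ, glueWith_apply_not_mem _ _ _ heΛ]
    have hfwd : Fwd p (frameCell w e) := hqc ▸ fwd_baseCell_frameCell hw q he
    exact h (frameCell w e) (cellAdj_of_fwd hfwd) (frameCell_notMem_of_notMem hw heΛ) e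
      (mem_cellEdges_frameCell hw e)

end Lemmas

end Summit.QuantumFields.YangMills.Cruxes.IR.BlockedActivity

end
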